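import Summits.NavierStokesRegularity.FluidComputer.RowEncloseCoef
import Summits.NavierStokesRegularity.FluidComputer.RowChainSound
import Summits.NavierStokesRegularity.FluidComputer.RowModelSound
import HarnessLib

/-!
# `Row.cert`: a passing row check certifies its row model
# (`pub-fluidc-bp3/R1-DESIGN.md` §7.11 (2) / §8.8 (2) / §9.4 — `structure Row` + per-row soundness)

HONEST FRAMING (cell `pub-fluidc`, blueprint seat bp3, gen 20): low prior, high value-of-information
experiment on Tao's machine paradigm; NOT a claim that NS blows up. This file contains no fluid
mechanics: it assembles the interval-arithmetic soundness lemmas of the row check into the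
hypothesis record `RowModel.Cert` of the analytic per-row theorem `RowModel.row_sound_on`.

`toModel` builds the `RowModel` of a row from its data `r : RowData`, real frames `Fr : r.Frames`
(any real matrices in the interval tables), gate data enclosed by the row's couplings (`GateOK`),
the row start `T₀` and a member (`MemberData`): reference `x̂(t) = Σ CQ_m (t−T₀)^m`, frames
`A(t) = A₀ + ((t−T₀)/H)ΔA` (slot rows `1..8`), `G`, `R = I − T̂A`, `J = J(x̂)`, `Q = F` (the field
is quadratic), substep `h = H/2^S`, `S − msub` squarings, `2^msub` blocks, and every table = the
real view of the kernel integer (`/2^P`). **`cert`**: if `rowPass ∧ encOK` and the frames follow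
the lock convention (row `0` of `A₀`, `A₁` vanishes off column `p`), then `Cert (toModel …)` — all
forty fields. **`row_sound`** is the corollary through `RowModel.row_sound_on`.

[cite: Tao2016AveragedNS, §5.5 Thm 5.3 (5.5)]
-/

namespace Summit.NavierStokesRegularity.FluidComputer

open Literature.Analysis.FluidPDE.FluidComputer
open Literature.Analysis.ValidatedNumerics.Numerics (cdiv)

namespace RowCheck

open DIVec ChainField Finset Real Set Matrix

namespace RowData

variable (r : RowData)

/-- Gate data enclosed by the row's couplings: reals `g`, `Λ` with `cU ∋ g`, `cD ∋ Λg` and the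
rational couplings `qU = g`, `qD = Λg` used by the defect bound (`Type`-valued record).
[folklore] -/
structure GateOK : Type where
  /-- upstream gate constants -/
  g : GateData
  /-- level ratio -/
  Λ : ℝ
  /-- `cU ∋ g` -/
  hU : r.cU.Mem r.P g
  /-- `cD ∋ Λg` -/
  hD : r.cD.Mem r.P (scaled g Λ)
  /-- `qU = g` -/
  hqU : ∀ c, gsel g c = r.qU c
  /-- `qD = Λg` -/
  hqD : ∀ c, Λ * gsel g c = r.qD c

/-- The member a row is applied to (its trajectory, defect, domain, phase map). [folklore] -/
structure MemberData : Type where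
  /-- the member -/
  y : ℝ → Fin 9 → ℝ
  /-- its defect -/
  δF : ℝ → Fin 9 → ℝ
  /-- where it is differentiable -/
  D : Set ℝ
  /-- phase map -/
  s : ℝ → ℝ
  /-- its right derivative -/
  sd : ℝ → ℝ

variable {r}

/-- **The row model of a row.** [folklore] -/
noncomputable def toModel (Fr : r.Frames) (G : r.GateOK) (T0 : ℝ) (m : MemberData) :
    RowModel (Fin 8) (Fin 9) where
  p := r.p
  T₀ := T0
  h := r.hR
  S := r.S - r.msub
  nb := 2 ^ r.msub
  F := F G.g G.Λ
  Q := F G.g G.Λ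
  xh t := xh r.CQ (t - T0)
  xh' t := xhd r.CQ (t - T0)
  Jm t := Jmat G.g G.Λ (xh r.CQ (t - T0))
  Am t := fun i b => Fr.Av ((t - T0) / r.Hq) i.succ b
  Am' _ := fun i b => Fr.ADm i.succ b
  G t := Fr.Gv ((t - T0) / r.Hq)
  Rr t := Fr.Rv ((t - T0) / r.Hq)
  y := m.y
  δF := m.δF
  D := m.D
  s := m.s
  sd := m.sd
  c := r.cR
  η := r.etaR
  η' := r.etapR
  ρ := r.rhoR
  Φlo := r.PhiloR
  B := fun i j => r.BR i j
  E := fun i k => r.ER i k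
  φ := r.phiR
  Wbar := r.WbarR
  Ebar := r.EbarR
  FQ := r.FQR
  δ := r.δR
  DB := r.DBR
  Jpm := r.JpmR
  CF := fun i b => r.CFR i b
  APm := fun i b => r.APmR i b
  Gm := fun a i => r.GmR a i
  Rm := fun a b => r.RmR a b
  Ad n := fun i k => r.AdR n i k
  bd := r.bdR
  An n := fun i k => r.AnR n i k
  bn := r.bnR
  ub := r.ubR

variable (Fr : r.Frames) (G : r.GateOK) (T0 : ℝ) (m : MemberData)

/-- The flags a passing row carries (all seven). [folklore] -/
theorem flags (hok : r.rowPass = true) :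
    r.rowCheck.closOK = true ∧ r.ph'.ok = true ∧ r.sb'.ok = true ∧ r.rowCheck.hOK = true ∧
      r.signsOK = true := by
  simp only [rowPass, rowOK, Out.ok, Bool.and_eq_true] at hok
  rw [rowCheck_eq] at hok ⊢
  tauto

/-- Row end of the model is `T₀ + H`. [folklore] -/
theorem T1_eq (hh : r.rowCheck.hOK = true) (hm : r.msub ≤ r.S) :
    (toModel Fr G T0 m).T₁ = T0 + r.Hq := by
  simp only [RowModel.T₁, RowModel.Hb, toModel, hR_eq hh]
  push_cast
  obtain ⟨k, hk⟩ := Nat.exists_eq_add_of_le hm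
  rw [hk, Nat.add_sub_cancel_left, pow_add]
  field_simp

/-- `FQ ≥ 0`, `δ ≥ 0`, `DB ≥ 0`. [folklore] -/
theorem radii_nonneg (G : r.GateOK) (hn : r.signsOK = true) (he : r.encOK = true) (b : Fin 9) :
    0 ≤ r.FQR b + r.δR b + r.DBR b := by
  obtain ⟨-, hEb, -, hDEL, -, -, hH⟩ := nnOK_iff.mp hn
  obtain ⟨-, -, hlen, -⟩ := (encOK_iff r).mp he
  have hHr : (0 : ℝ) < r.Hq := by exact_mod_cast hH
  have h1 : 0 ≤ r.FQR b := by
    have h := abs_F_le_FabsB G.hU G.hD (E := fun _ => (0 : ℝ)) (EB := r.Eb)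
      (fun k => by simpa [EbarR, toR] using EbarR_nonneg hn k) b
    rw [FQR, toR, FQ, Vec.get_mk']
    exact (abs_nonneg _).trans h
  have h2 : 0 ≤ r.δR b := toR_nonneg (hDEL b)
  have h3 : 0 ≤ r.DBR b := by
    have h := abs_defect_le G.hqU G.hqD hlen r.P hHr (u := 0) ⟨le_rfl, hHr.le⟩ b
    rw [DBR, toR, DB, Vec.get_mk']
    exact (abs_nonneg _).trans h
  linarith

/-- The reconstruction identity `G(Av) + Rv = v` for `v_p = 0`, given the lock convention on the
frames (row `0` of `A(v)` vanishes off column `p`). [folklore] -/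
theorem rec_identity (hrow : ∀ b, b ≠ r.p → Fr.A0 0 b = 0 ∧ Fr.A1 0 b = 0) (w : ℝ)
    (v : Fin 9 → ℝ) (hv : v r.p = 0) :
    (Fr.Gv w *ᵥ ((fun i b => Fr.Av w i.succ b : Matrix (Fin 8) (Fin 9) ℝ) *ᵥ v)) + Fr.Rv w *ᵥ v =
      v := by
  have h0 : ∑ k, Fr.Av w 0 k * v k = 0 := by
    refine Finset.sum_eq_zero fun k _ => ?_
    by_cases hk : k = r.p
    · rw [hk, hv, mul_zero]
    · have : Fr.Av w 0 k = 0 := by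
        obtain ⟨ha, hb⟩ := hrow k hk
        simp [Frames.Av, Frames.dA, Matrix.add_apply, Matrix.smul_apply, Matrix.sub_apply, ha, hb]
      rw [this, zero_mul]
  ext a
  simp only [Pi.add_apply, Matrix.mulVec, dotProduct, Frames.Gv, Frames.Rv, Matrix.sub_apply,
    Matrix.one_apply, Matrix.mul_apply]
  have e2 : ∑ k, ((if a = k then (1 : ℝ) else 0) - ∑ j, Fr.Tv w a j * Fr.Av w j k) * v k =
      v a - ∑ j, Fr.Tv w a j * ∑ k, Fr.Av w j k * v k := by
    simp only [sub_mul, Finset.sum_sub_distrib, ite_mul, one_mul, zero_mul, Finset.sum_ite_eq,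
      Finset.mem_univ, if_true, Finset.sum_mul, Finset.mul_sum]
    congr 1
    rw [Finset.sum_comm]
    exact Finset.sum_congr rfl fun j _ => Finset.sum_congr rfl fun k _ => by ring
  rw [e2, Fin.sum_univ_succ (fun j => Fr.Tv w a j * ∑ k, Fr.Av w j k * v k), h0, mul_zero,
    zero_add]
  ring

/-- **A passing row check certifies the row model** (all fields of `RowModel.Cert`). [folklore] -/
noncomputable def cert (hok : r.rowPass = true) (he : r.encOK = true)
    (hrow : ∀ b, b ≠ r.p → Fr.A0 0 b = 0 ∧ Fr.A1 0 b = 0) : (toModel Fr G T0 m).Cert := by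
  obtain ⟨hcl, hph, hsb, hh, hn⟩ := flags hok
  obtain ⟨hhR, hc0, hB0, hφ0, hE0, hIE, hη, hη', hAd0, hbd0, hAdsq, hbdsq, hAn0, hbn0, hAnsq,
    hbnsq, hAnI, hbnn, hub, hsup⟩ := chain_sound hok
  have hsg := nnOK_iff.mp hn
  obtain ⟨hK, hHlo, hlen, hmS⟩ := (encOK_iff r).mp he
  have hH : (0 : ℝ) < r.Hq := by exact_mod_cast hsg.2.2.2.2.2.2
  have hT1 := T1_eq Fr G T0 m hh hmS
  -- `t ∈ [T₀, T₁]` ⇒ `u = t − T₀ ∈ [0, H]`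
  have hu : ∀ t ∈ Icc (toModel Fr G T0 m).T₀ (toModel Fr G T0 m).T₁,
      t - T0 ∈ Icc (0 : ℝ) r.Hq := by
    intro t ht
    rw [hT1] at ht
    exact ⟨by simp only [toModel] at ht; linarith [ht.1], by linarith [ht.2]⟩
  exact {
    hh := hhR
    hnb := pow_pos (by norm_num) _
    hc := hc0
    hρ0 := toR_nonneg hsg.2.2.2.2.2.1
    hxh := fun t a => by
      show HasDerivAt (fun x => xh r.CQ (x - T0) a) (xhd r.CQ (t - T0) a) t
      have h := (hasDerivAt_xh r.CQ a (t - T0)).comp t ((hasDerivAt_id' t).sub_const T0)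
      rw [mul_one] at h
      exact h
    hA := fun t i b => by
      show HasDerivAt (fun x => Fr.Av ((x - T0) / r.Hq) i.succ b) (Fr.ADm i.succ b) t
      have h := ((((hasDerivAt_id' t).sub_const T0).div_const (r.Hq : ℝ)).mul_const
        (Fr.dA i.succ b)).const_add (Fr.A0 i.succ b)
      have e : (fun x => Fr.A0 i.succ b + (x - T0) / r.Hq * Fr.dA i.succ b) =
          fun x => Fr.Av ((x - T0) / r.Hq) i.succ b := by
        funext x; simp [Frames.Av, Matrix.add_apply, Matrix.smul_apply]
      rw [e] at h
      refine h.congr_deriv ?_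
      rw [Frames.ADm]
      ring
    hF := fun t v => taylor_split_mat G.g G.Λ _ v
    hQ := fun v hv a => by
      have h := abs_F_le_FabsB G.hU G.hD (E := v) (EB := r.Eb)
        (fun k => by simpa [toModel, EbarR, toR] using hv k) a
      simpa [toModel, FQR, toR, FQ, Vec.get_mk'] using h
    hrec := fun t _ v hv => rec_identity Fr hrow _ v hv
    hΦ := fun t ht => Philo_le' he (hu t ht) hph
    hDB := fun t ht a => by
      have h := abs_defect_le G.hqU G.hqD hlen r.P hH (hu t ht) a
      simpa [toModel, DBR, toR, DB, Vec.get_mk'] using h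
    hJp := fun t ht b => Jp_le' G.hU G.hD (hu t ht) b
    hGm := fun t ht a i => G_le Fr hH (hu t ht) a i
    hRm := fun t ht a b => R_le Fr hH (hu t ht) a b
    hKB := fun t ht s hs i j => by
      have h := K_le Fr hsb he G.hU G.hD hH (hu t ht) hs i j
      have e1 : (toModel Fr G T0 m).K0 t i j = (Fr.ADm * Fr.Gv ((t - T0) / r.Hq)) i.succ j := by
        simp [RowModel.K0, toModel, Matrix.mul_apply]
      have e2 : (toModel Fr G T0 m).M t i j = (Fr.Av ((t - T0) / r.Hq) * r.Ptm (t - T0) *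
          Jmat G.g G.Λ (xh r.CQ (t - T0)) * Fr.Gv ((t - T0) / r.Hq)) i.succ j := by
        simp [RowModel.M, RowModel.APJ, RowModel.APt, RowModel.Pt, Ptm, toModel, Matrix.mul_apply]
      rw [e1, e2]
      exact h
    hCF := fun t ht i b => by
      have h := CF_le Fr hsb he G.hU G.hD hH (hu t ht) hsg.2.2.2.2.2.1 i b
      have e1 : (toModel Fr G T0 m).AmR t i b = (Fr.ADm * Fr.Rv ((t - T0) / r.Hq)) i.succ b := by
        simp [RowModel.AmR, toModel, Matrix.mul_apply]
      have e2 : (toModel Fr G T0 m).APJR t i b = (Fr.Av ((t - T0) / r.Hq) * r.Ptm (t - T0) *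
          Jmat G.g G.Λ (xh r.CQ (t - T0)) * Fr.Rv ((t - T0) / r.Hq)) i.succ b := by
        simp [RowModel.APJR, RowModel.APJ, RowModel.APt, RowModel.Pt, Ptm, toModel,
          Matrix.mul_apply]
      rw [e1, e2]
      exact h
    hAPm := fun t ht i b => by
      have h := APm_le Fr hsb he hH (hu t ht) i b
      have e : (toModel Fr G T0 m).APt t i b =
          (Fr.Av ((t - T0) / r.Hq) * r.Ptm (t - T0)) i.succ b := by
        simp [RowModel.APt, RowModel.Pt, Ptm, toModel, Matrix.mul_apply]
      rw [e]
      exact h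
    hDp := Dp_lt hph
    hρ := rho_ge hph
    hφ := fun i => phi_ge (radii_nonneg G hn he) i
    hB0 := hB0
    hφ0 := hφ0
    hEbar0 := EbarR_nonneg hn
    hE0 := hE0
    hIE := hIE
    hη := hη
    hη' := hη'
    hAd0 := hAd0
    hbd0 := hbd0
    hAdsq := fun n _ => hAdsq n
    hbdsq := fun n _ => hbdsq n
    hAn0 := hAn0
    hbn0 := hbn0
    hAnsq := fun n _ => hAnsq n
    hbnsq := fun n _ => hbnsq n
    hAnI := fun n _ => hAnI n
    hbnn := fun n _ => hbnn n
    hub := fun j _ => hub j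
    hsup := hsup
    hEbar := closure_sound hcl }

/-- **Per-row soundness** (R1-DESIGN §7.11 (2)): on a passing row, a member whose data satisfy the
`MemberOn` hypotheses up to `Ts ≤ T₀ + H` and whose frame coordinates start in the box `u` stays in
the certified boxes, its frame coordinates are in the tabulated block boxes at block starts, and its
phase rate is within `ρ` of `1`. [folklore] -/
theorem row_sound (hok : r.rowPass = true) (he : r.encOK = true)
    (hrow : ∀ b, b ≠ r.p → Fr.A0 0 b = 0 ∧ Fr.A1 0 b = 0) {Ts : ℝ}
    (hmem : (toModel Fr G T0 m).MemberOn Ts) (hTs0 : T0 ≤ Ts) (hTs : Ts ≤ T0 + r.Hq)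
    (hu0 : ∀ i, |(toModel Fr G T0 m).z T0 i| ≤ r.ubR 0 i) :
    (∀ t ∈ Icc T0 Ts, ∀ a, |(toModel Fr G T0 m).e t a| ≤ r.EbarR a) ∧
    (∀ t ∈ Icc T0 Ts, ∀ i, |(toModel Fr G T0 m).z t i| ≤ r.WbarR i) ∧
    (∀ j : ℕ, T0 + (j : ℝ) * (2 ^ (r.S - r.msub) * r.hR) ≤ Ts →
      ∀ i, |(toModel Fr G T0 m).z (T0 + (j : ℝ) * (2 ^ (r.S - r.msub) * r.hR)) i| ≤ r.ubR j i) ∧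
    (∀ t ∈ Ico T0 Ts, |m.sd t - 1| ≤ r.rhoR) := by
  obtain ⟨-, -, -, hh, -⟩ := flags hok
  obtain ⟨-, -, -, hmS⟩ := (encOK_iff r).mp he
  have hT1 := T1_eq Fr G T0 m hh hmS
  have h := RowModel.row_sound_on (cert Fr G T0 m hok he hrow) hmem (by exact hTs0)
    (by rw [hT1]; exact hTs) hu0
  exact h

end RowData

end RowCheck

end Summit.NavierStokesRegularity.FluidComputer
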